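import Summits.NavierStokesRegularity.NavierStokesRegularity.Theorems.RungBlowupCofinal.PrecessingProfileLambLoadBearing
import Summits.NavierStokesRegularity.NavierStokesRegularity.Theorems.RungBlowupCofinal.BandClosedNonlinearityExcluded
import Summits.NavierStokesRegularity.NavierStokesRegularity.Theorems.RungBlowupCofinal.SwirlOnlyProfilesExcluded
import Summits.NavierStokesRegularity.NavierStokesRegularity.Theorems.RungBlowupCofinal.OddProfilesExcluded
import HarnessLib

/-!
# WITNESS CENSUS for crux K1 `RungBlowupCofinal`: what a NON-TRIVIAL precessing rung profile cannot
# be — the kernel admissibility filters N3–N7 assembled into one theorem in the letters of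
# `Qlwave.IsPrecessingRungProfile L α C U Q E` (route `AngularGalerkinLadder`; theorems only)

Cell `ns-blowup`, seat `ns-blowup-circuit` (g12, AGL Lean seat). Helper file for
`stmt-NavierStokesRegularity-19959`, line `Cruxes/RungBlowupCofinal/Lines/qlwave.lean` (stub
`stub_meanwave_profiles_cofinal`: EXISTENCE of non-trivial mean–wave profiles cofinally in `L`; by
`Qlwave.isPrecessingRungProfile_of_meanWave` every mean–wave profile `(V, W)` is a precessing rung
profile `U = V + W` with defect `E₀ + E₁ + waveFluctuation n W`). The K1 analogue of refuter g18's
K2 `ExcludedStrataCensus`: ONE importable statement listing, for a precessing rung profile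
`U ≢ 0` — band-limited of degree `≤ L`, divergence-free, smooth pressure `Q`, continuous
co-band-limited defect `E`, `−ΔU + ½U + ½DU·y + αJ₃U + (U·∇)U + ∇Q − E = 0`, tail
`‖U(y)‖ ≤ C/(‖y‖+1)` — the structures it CANNOT have:

* (N3) a rung-invisible nonlinearity: `(U·∇)U + ∇q` co-band-limited for some smooth `q`
  (`PrecessingProfileLambLoadBearing.eq_zero_of_convect_coband`, p564408 ← p564064 ← p563211);
* (N4) a rung-invisible Lamb vector `ω × U + ∇q`, in particular Beltrami `ω × U = 0` or
  `ω = λU` (`eq_zero_of_lamb_coband`, `eq_zero_of_beltrami`, `eq_zero_of_curl_eq_smul`);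
* (N5) at `α = 0`: a band-limited self-advection `(U·∇)U` (`BandClosedNonlinearityExcluded`,
  p571268; for `α ≠ 0` the same holds in the Pineau–Vicol window, `witness_census_window`);
* (N6) a swirl-only zonal shape `U = f·J`, `f` smooth axisymmetric, `Jy = (−y₁, y₀, 0)`
  (`SwirlOnlyProfilesExcluded.rungProfile_swirlOnly_eq_zero`, p572314);
* (N7) central evenness `U(−y) = U(y)`; oddness `σU(σ⁻¹y) = −U(y)` under any linear isometry `σ`
  commuting with `e₃ × ·`; for zonal `U` (`J₃U = 0`), oddness under ANY linear isometry
  (`OddProfilesExcluded`, p572710).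

(N1/N2 — the linear Liouville theorems — are the engine inside all of these; (S4) `V ≢ 0` for
mean–wave witnesses is `Qlwave.zonal_ne_zero_of_meanWave` in the line file itself.) LABEL: KERNEL,
unconditional (N5's window conjunct rests on the tree's DISCHARGED Pineau–Vicol theorem). WHAT THIS
IS NOT: not Navier–Stokes evidence; no profile is constructed or shown to exist; the generic
mean–wave shape `V_pol + V_tor + W` without symmetry is untouched. References:
[cite: PineauVicol2026, Theorem 1.4 (arXiv:2607.09619 p. 4)]; [cite: KochNadirashviliSereginSverak2009, §1 (1.5), Lemma 3.1];
[cite: MajdaBertozziCUP2002, §1.2 Prop. 1.1].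
-/

noncomputable section

namespace Summit.NavierStokesRegularity.AngularGalerkinLadderPrecessingRungProfileWitnessCensus

open Set Function
open scoped ContDiff RealInnerProductSpace Laplacian
open Literature.Analysis.FluidPDE
open Summit.NavierStokesRegularity.FluidComputer Summit.NavierStokesRegularity.FluidComputer.AngularLadder
open Summit.NavierStokesRegularity

variable {L : ℕ} {α C : ℝ}
  {U E : EuclideanSpace ℝ (Fin 3) → EuclideanSpace ℝ (Fin 3)} {Q : EuclideanSpace ℝ (Fin 3) → ℝ}

/-- **WITNESS CENSUS (K1, precessing rung profiles).** A non-trivial precessing rung profile —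
in the letters of `Qlwave.IsPrecessingRungProfile L α C U Q E` with `precResidual` unfolded — has
NONE of the structures N3, N4, N5 (`α = 0`), N6, N7. [folklore] -/
theorem witness_census (hU : IsBandLimited L U) (hdiv : VectorCalculus.IsDivFree U)
    (hQ : ContDiff ℝ ∞ Q) (hEc : Continuous E) (hE : IsCobandLimited L E)
    (hres : ∀ y, -(Δ U) y + (1 / 2 : ℝ) • U y + (1 / 2 : ℝ) • fderiv ℝ U y y + α • angGen 2 U y +
      convect U U y + gradient Q y - E y = 0)
    (hdec : ∀ y, ‖U y‖ ≤ C / (‖y‖ + 1)) (hne : ∃ y, U y ≠ 0) :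
    -- N3: the nonlinearity is not rung-invisible (co-band modulo a gradient)
    (∀ q : EuclideanSpace ℝ (Fin 3) → ℝ, ContDiff ℝ ∞ q →
      ¬ IsCobandLimited L (fun y => convect U U y + gradient q y)) ∧
    -- N4: the Lamb vector is not rung-invisible; not Beltrami; not a curl eigenfield
    (∀ q : EuclideanSpace ℝ (Fin 3) → ℝ, ContDiff ℝ ∞ q →
      ¬ IsCobandLimited L (fun y => cross (curl U y) (U y) + gradient q y)) ∧
    (¬ ∀ y, cross (curl U y) (U y) = 0) ∧
    (∀ lam : ℝ, ¬ ∀ y, curl U y = lam • U y) ∧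
    -- N5 (steady case): the self-advection is not band-limited when `α = 0`
    (α = 0 → ¬ IsBandLimited L (convect U U)) ∧
    -- N6: not a swirl-only zonal field
    (∀ f : EuclideanSpace ℝ (Fin 3) → ℝ, ContDiff ℝ ∞ f → IsAxisymmetricScalar f →
      ¬ ∀ y, U y = f y • rotGen y) ∧
    -- N7: not centrally even; not odd under an isometry commuting with `e₃ × ·`;
    --     if zonal, not odd under any isometry
    (¬ ∀ y, U (-y) = U y) ∧
    (∀ σ : EuclideanSpace ℝ (Fin 3) ≃ₗᵢ[ℝ] EuclideanSpace ℝ (Fin 3),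
      (∀ w, σ (crossCLM (axis 2) w) = crossCLM (axis 2) (σ w)) →
      ¬ ∀ y, σ (U (σ.symm y)) = -U y) ∧
    ((∀ y, angGen 2 U y = 0) → ∀ σ : EuclideanSpace ℝ (Fin 3) ≃ₗᵢ[ℝ] EuclideanSpace ℝ (Fin 3),
      ¬ ∀ y, σ (U (σ.symm y)) = -U y) := by
  obtain ⟨y₀, hy₀⟩ := hne
  -- every filter concludes `U = 0` (or `∀ y, U y = 0`), contradicting `U y₀ ≠ 0`
  have absurd_of_zero : U = 0 → False := fun h => hy₀ (by rw [h]; rfl)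
  have heq : ∀ y, -(Δ U) y + (1 / 2 : ℝ) • U y + (1 / 2 : ℝ) • fderiv ℝ U y y + α • angGen 2 U y +
      convect U U y + gradient Q y = E y := fun y => sub_eq_zero.1 (hres y)
  refine ⟨fun q hq hX => ?_, fun q hq hΛ => ?_, fun hB => ?_, fun lam hcurl => ?_, fun hα hN => ?_,
    fun f hf hax hUf => ?_, fun heven => ?_, fun σ hσe hodd => ?_, fun hzonal σ hodd => ?_⟩
  · exact absurd_of_zero (AngularGalerkinLadderPrecessingProfileLambLoadBearing.eq_zero_of_convect_coband
      hU hdiv hQ hEc hE hres hdec hq hX)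
  · exact absurd_of_zero (AngularGalerkinLadderPrecessingProfileLambLoadBearing.eq_zero_of_lamb_coband
      hU hdiv hQ hEc hE hres hdec hq hΛ)
  · exact absurd_of_zero (AngularGalerkinLadderPrecessingProfileLambLoadBearing.eq_zero_of_beltrami
      hU hdiv hQ hEc hE hres hdec hB)
  · exact absurd_of_zero (AngularGalerkinLadderPrecessingProfileLambLoadBearing.eq_zero_of_curl_eq_smul
      hU hdiv hQ hEc hE hres hdec hcurl)
  · subst hα
    exact absurd_of_zero (AngularGalerkinLadderBandClosedNonlinearityExcluded.eq_zero_of_convect_bandLimited_steady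
      hU hdiv hQ hE heq hdec hN)
  · exact hy₀ (AngularGalerkinLadderSwirlOnlyProfilesExcluded.rungProfile_swirlOnly_eq_zero hf hax hUf
      hU hdiv hQ hEc hE hres hdec y₀)
  · exact hy₀ (AngularGalerkinLadderOddProfilesExcluded.rungProfile_eq_zero_of_even hU hdiv hQ hEc hE
      hres hdec heven y₀)
  · exact hy₀ (AngularGalerkinLadderOddProfilesExcluded.rungProfile_eq_zero_of_symmetryOdd σ hσe hU hdiv
      hQ hEc hE hres hdec hodd y₀)
  · exact absurd_of_zero (AngularGalerkinLadderOddProfilesExcluded.eq_zero_of_symmetryOdd_of_zonal σ hU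
      hdiv hQ hE hEc heq hdec hzonal hodd)

/-- **WITNESS CENSUS, N5 with the Pineau–Vicol window.** For every Type-I constant `C` there are
`α₁, α₂ > 0` such that no non-trivial precessing rung profile with tail constant `C` and
`|α| < α₁ ∨ |α| > α₂` has band-limited self-advection. [cite: PineauVicol2026, Theorem 1.4 (arXiv:2607.09619 p. 4)] -/
theorem witness_census_window (C : ℝ) :
    ∃ α₁ α₂ : ℝ, 0 < α₁ ∧ 0 < α₂ ∧
      ∀ (L : ℕ) (α : ℝ) (U E : EuclideanSpace ℝ (Fin 3) → EuclideanSpace ℝ (Fin 3))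
        (Q : EuclideanSpace ℝ (Fin 3) → ℝ),
        IsBandLimited L U → VectorCalculus.IsDivFree U → ContDiff ℝ ∞ Q → IsCobandLimited L E →
        (∀ y, -(Δ U) y + (1 / 2 : ℝ) • U y + (1 / 2 : ℝ) • fderiv ℝ U y y + α • angGen 2 U y +
          convect U U y + gradient Q y - E y = 0) →
        (∀ y, ‖U y‖ ≤ C / (‖y‖ + 1)) → (∃ y, U y ≠ 0) → (|α| < α₁ ∨ α₂ < |α|) →
        ¬ IsBandLimited L (convect U U) := by
  obtain ⟨α₁, α₂, h1, h2, h⟩ :=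
    AngularGalerkinLadderBandClosedNonlinearityExcluded.rungProfile_eq_zero_of_convect_bandLimited C
  refine ⟨α₁, α₂, h1, h2, fun L α U E Q hU hdiv hQ hE hres hdec hne hα hN => ?_⟩
  obtain ⟨y₀, hy₀⟩ := hne
  exact hy₀ (h L α U E Q hU hdiv hQ hE hres hdec hN hα y₀)

/-- **Corollary: the witness class is rigid under the obvious symmetric ansätze.** In particular a
non-trivial precessing rung profile is neither centrally even nor swirl-only zonal nor Beltrami —
the three shapes a first numerical search would try. [folklore] -/
theorem witness_not_even_not_swirlOnly_not_beltrami (hU : IsBandLimited L U)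
    (hdiv : VectorCalculus.IsDivFree U) (hQ : ContDiff ℝ ∞ Q) (hEc : Continuous E)
    (hE : IsCobandLimited L E)
    (hres : ∀ y, -(Δ U) y + (1 / 2 : ℝ) • U y + (1 / 2 : ℝ) • fderiv ℝ U y y + α • angGen 2 U y +
      convect U U y + gradient Q y - E y = 0)
    (hdec : ∀ y, ‖U y‖ ≤ C / (‖y‖ + 1)) (hne : ∃ y, U y ≠ 0) :
    (¬ ∀ y, U (-y) = U y) ∧
    (∀ f : EuclideanSpace ℝ (Fin 3) → ℝ, ContDiff ℝ ∞ f → IsAxisymmetricScalar f →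
      ¬ ∀ y, U y = f y • rotGen y) ∧
    (¬ ∀ y, cross (curl U y) (U y) = 0) := by
  obtain ⟨-, -, hB, -, -, h6, h7, -, -⟩ := witness_census hU hdiv hQ hEc hE hres hdec hne
  exact ⟨h7, h6, hB⟩

end Summit.NavierStokesRegularity.AngularGalerkinLadderPrecessingRungProfileWitnessCensus

end
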